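/-
Copyright: lit-balaban Phase-2 proof seat p34 (gen 19).  Statement-level skeleton of a published paper; no proof claims beyond what the
kernel checks below.
-/
import Literature.MathematicalPhysics.QuantumFieldTheory.BalabanImbrieJaffe1984to88.BIJ88NeumannPropagatorActualBackground
import Literature.MathematicalPhysics.QuantumFieldTheory.BalabanImbrieJaffe1984to88.BIJ88NeumannPropagatorSmallFieldCloseHolderCubeTorus
import Literature.MathematicalPhysics.QuantumFieldTheory.BalabanImbrieJaffe1984to88.BIJ88NeumannPropagatorSmallFieldCloseCubeTorus

/-!
# [BalabanImbrieJaffe1985] §7.3 p. 326 — «The propagators arising from Δ_k(u_k), under the restriction (7.3.1) on the gauge field, also satisfy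
# the regularity and decay estimates of [7]»: **THE REMAINING MEMBERS OF [7]'s THEOREM p. 573 — (1.9) HÖLDER, (1.11)–(1.12) δG VALUE /
# COVARIANT DERIVATIVE / HÖLDER — FOR THE TORUS CUBE PROPAGATORS OF RECORD `G_k(□,u_k)` AT THE ACTUAL BACKGROUND `u_k(e_k, v)` (4.5.4),
# HYPOTHESIS-FREE** (file 2 after `BIJ88NeumannPropagatorActualBackground`, whose §1–§2 passage is applied to p27's and p30's cube members).

T. Bałaban, J. Imbrie, A. Jaffe, *Renormalization of the Higgs model: minimizers, propagators and the stability of mean field theory*, Commun.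
Math. Phys. **97** (1985) 299–329 [BalabanImbrieJaffe1985] = [I], §7.3 p. 326 [PDF 28]; T. Bałaban, J. Imbrie, A. Jaffe, *Effective action and
cluster properties of the abelian Higgs model*, Commun. Math. Phys. **114** (1988) 257–315 [BalabanImbrieJaffe1988], p. 263 [PDF 7]; [7] =
T. Bałaban, *Regularity and decay of lattice Green's functions*, Commun. Math. Phys. **89** (1983) 571–597 [Balaban1983RegularityDecay],
Theorem p. 573 (1.9)–(1.12).

statement-level skeleton of published theorems with citation tags; proofs where landed; nothing here is a claim about the Yang–Mills mass gap

PDF held: `paper:balaban1985-cmp97-bij-higgs-minimizers` (journal page = PDF page + 298), p. 326 [PDF 28]; `paper:balaban1983-cmp89-regularity-decay`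
(journal page = PDF page + 570), p. 573 [PDF 3]; `paper:balaban1988-cmp114-bij-abelian-higgs-effective-action` (journal page = PDF page + 256),
p. 263 [PDF 7].

CITATION HEADER (lean-in-tree rule).  Part of the lit-balaban TYPED SKELETON (HOME `run/shared/lean/pub/lit-balaban/`), PHASE-2 proof seat
p34 gen 19 (unit `lit-balaban-p34-g19`; TAKING line HOME/STATUS.md 2026-08-23T08:17:29Z + filing note; free-target protocol G.5-34(d); p27 g37
08:18:22Z «equally welcome … to avoid two files», p30/r15/r18 cc).  WHAT IS REPRODUCED: located MEMBERS of rows **C1.Eq7.3.1-7.3.2** (owner r15)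
and **C2.Claim@263** / **C2.Eq2.31** (owner r18): p27's (1.9) / δG-Hölder cube members and p30's (1.11)–(1.12) δG value / covariant-derivative
cube members — all proved in the tree at a GENERAL small-plaquette `U(1)` field — at the ACTUAL background `u_k = actualBgU1 hd2 k e v` under the
PRINTED unit-lattice hypothesis (7.3.1) on `v`, with ONE threshold `e_k𝓅(e_k) ≤ 1/(23D²K(D, L))`.  Together with file 1's (1.10) value /
covariant-derivative members this is [7]'s Theorem (1.9)–(1.12) — every member — for the tree's torus cube propagators at the backgrounds of
record (the analogue, in the tree's centred-block / torus conventions, of p33's `BIJ85RegionPropagatorsActualBgMembers` in r01's [7]-carrier).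
No row is restated and no head changes.
USED BY NAME: file 1's `smallPlaquette_actualBg` (the packaged passage: front (δ) `plaqSmall_actualBg_of_hyp731` + `smallness_pack`); p27's
`BIJ88NeumannPropagatorSmallFieldCubeHolderDecay.holder19_smallPlaquette_cube_uniform` ((1.9), order `1 + α`),
`BIJ88NeumannPropagatorSmallFieldCloseHolderCubeTorus.closeHolder112_smallPlaquette_cube_torus` (δG Hölder); p30's
`BIJ88NeumannPropagatorSmallFieldCloseCubeTorus.close112_smallPlaquette_cube_torus` / `close112_smallPlaquette_cube_torus_deriv` ((1.11)–(1.12)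
value / covariant derivative); p31's `gBox`, pv07/p31's `cubeT`, p27's `stairHol`.  Kind: theorems only (no definition, no `Prop`-valued fact).

THE PRINTED TEXT, verbatim.  [I] p. 326: *"The propagators arising from Δ_k(u_k), under the restriction (7.3.1) on the gauge field, also
satisfy the regularity and decay estimates of [7]."*  [7] p. 573: *"Theorem (Proposition 2.1 of [1]). For α < 1 there exist positive constants
δ₀, c₀, R₀ independent of A, k, Ω and depending on d, M only, c₀ on α also, such that for e sufficiently small and for an arbitrary function
f : Ω → R^N, we have [(1.9)] for x, x′ ∈ Ω, and satisfying the condition dist({x, x′}, Ω^c) ≥ R₀. Similarly [(1.10)] for x ∈ Ω, dist(x, Ω^c) ≥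
R₀. If Ω ⊂ Ω₀, then for δG_k(Ω, Ω₀, A) = G_k(Ω, A) − G_k(Ω₀, A), (1.11) we have the inequalities (1.9), (1.10) with … the additional factor
exp(−δ₀ dist(supp f, Ω^c) − δ₀ dist({x, x′}, Ω^c)) (1.12)"*.  [BalabanImbrieJaffe1988] p. 263: *"Bounds analogous to (2.30), (2.31) hold for
covariant derivatives and Hölder derivatives of G_{k,loc}(u) of order less than two."*

THE ARGUMENT.  File 1 §1 (`plaqSmall_actualBg_of_hyp731`): under (7.3.1) and `e𝓅(e) ≤ ½`, every fine plaquette of `u_k` is within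
`K·e𝓅(e)/(L^k)²` of `1`, `K = (π/2)K_R(D, L)`, in the `plaqC` (all orientations) and `plaqHol` forms; file 1 §2 (`smallness_pack`): under
`e𝓅(e) ≤ 1/(23D²K)` the value `θ = K·e𝓅(e)/(L^k)²` meets `2D³(L^{2k}θ)² ≤ 1`, the `(T, ½)` condition and `(L^{2k}θ)² ≤ 1/500`; the four members are
p27's / p30's theorems at `U := u_k` and this `θ`.

WHAT IS PROVED (0 `sorry`; standard axioms; theorems only; `D = d + 1 ∈ {2, 3}`, `L = ℓ + 1` odd `> 1`, `1 ≤ k ≤ K`, `2(L^k − 1) + 4 < |T|`,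
`□ = cubeT hPd (L^k) c (L^k·M)` a fitting cube shorter than the torus, `G_k(X, u_k) = gBox (α_kL^{kD}) ε⁻¹ u_k k X`; ONE threshold
`e𝓅(e) ≤ c₁ = 1/(23D²K)`, constants from `(d, L, a[, α])` only).
* **`holder19_cube_actualBg`** — [7] (1.9), top order `1 + α` (`0 ≤ α < 1`): `(L^k/|x₀−x₁|_∞)^α·‖U(Γ_{x₀x₁})(D_{u_k}G_k(□,u_k)f)(⟨x₁,μ⟩) −
  (D_{u_k}G_k(□,u_k)f)(⟨x₀,μ⟩)‖ ≤ c₀(L^kε)e^{−t₀D_f/L^k}‖f‖_∞` for `x₀ ≠ x₁` both `3L^k`-deep in `□` (p27's axis-staircase transport `stairHol`).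
* **`close112_cube_actualBg`** / **`close112_cube_deriv_actualBg`** — [7] (1.11)–(1.12), value / covariant derivative, `Ω₀ = T_η`:
  `‖(G_k(□,u_k)f − G_k(T,u_k)f)(x)‖ ≤ (L^kε)²·c₃e^{−δ₃D_f/L^k}e^{−δ₃(D_b+D_{bf})/L^k}‖f‖_∞` at rows `x ∈ □` of depth `≥ 10L^k`, `f` supported in `□`,
  `D_b ≤ dist_∞(x, T∖□)`, `D_{bf} ≤ dist_∞(supp f, T∖□)`; the same for `D_{u_k}` at depth `≥ 14L^k` with one power of `L^kε`.
* **`closeHolder112_cube_actualBg`** — [7] (1.11)–(1.12), Hölder member of top order (`0 ≤ α < 1`), depth `≥ 17L^k`.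
HONEST SCOPE.  File 1's (i)–(iii) verbatim ((7.3.1) on all unit plaquettes; tree conventions; «e sufficiently small» = the one threshold with
p33's all-tori `K_R`); the members' own scope notes apply verbatim (p27: axis-rooted staircase transport, `D ∈ {2,3}`, odd `L`, `k ≤ K`, deep
pairs `3L^k`; p30: `Ω₀ = T_η` only — the general nested pair `□ ⊆ Ω` is p30's `…CloseRegion` lane —, depths `10/14/17·L^k` = the tree's `R₀`,
`f` supported in `□`; constants existential; method divergence from [7]'s random walk as disclosed there).  Literature + Mathlib only.  Unit
`lit-balaban-p34` (literature-prover-lit-balaban-p34-g19-0), 2026-08-23.  NOT summit progress.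
-/

open scoped BigOperators ComplexConjugate
open Finset Matrix

namespace Literature.MathematicalPhysics.QuantumFieldTheory.BalabanImbrieJaffe1984to88.BIJ88NeumannPropagatorActualBackgroundCube

open Literature.MathematicalPhysics.QuantumFieldTheory.Balaban1983to89 hiding Site Plaq
open LatticeFieldCalculus (supDist)
open BIJ88Sect3Statements (U1 toC cfg covD)
open BIJ85Sect1Model (U1Field plaq)
open BIJ85AbelianStokes (plaqC)
open BIJ85Eq454PlaqResidual (actualBgU1)
open BIJ88NeumannPropagator227Torus (gBox)
open BIJ88NeumannPropagatorFlatDecayCube (cubeT)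
open BIJ85ScalarPropagatorHolderDecay (stairHol)
open BIJ88NeumannPropagatorSmallFieldCubeHolderDecay (holder19_smallPlaquette_cube_uniform)
open BIJ88NeumannPropagatorSmallFieldCloseCubeTorus (close112_smallPlaquette_cube_torus close112_smallPlaquette_cube_torus_deriv)
open BIJ88NeumannPropagatorSmallFieldCloseHolderCubeTorus (closeHolder112_smallPlaquette_cube_torus)
open BIJ88NeumannPropagatorActualBackground (smallPlaquette_actualBg)
open Balaban1983to89 renaming Site → TSite, Plaq → TPlaq

noncomputable section

/-! ## §1 [7] (1.9): the Hölder member of top order for the cube propagators at the actual background -/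

/-- **[7] (1.9), HÖLDER MEMBER OF TOP ORDER `1 + α`, FOR THE TORUS CUBE PROPAGATORS `G_k(□,u_k)` AT THE ACTUAL BACKGROUND UNDER THE PRINTED
(7.3.1).**  For `D = d + 1 ∈ {2, 3}`, `L` odd `> 1`, `a > 0`, `𝓅`, `0 ≤ α < 1`: there are `c₁ > 0` (`= 1/(23D²K(D, L))`) and `t₀, c₀ > 0` (from
`(d, L, a, α)`) such that for EVERY torus `P` (`P.d = D`, `P.L = L`), every `1 ≤ k ≤ K` with `2(L^k − 1) + 4 < |T|`, every `0 < e ≤ 1` with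
`e𝓅(e) ≤ c₁`, every unit field `v` with (7.3.1) `‖v(∂q) − 1‖ ≤ e𝓅(e)`, every fitting cube `□ = c·L^k + Π[0, L^kM_i)` shorter than the torus,
every pair `x₀ ≠ x₁` with `dist_∞(x_i, T∖□) ≥ 3L^k`, every direction `μ` and every `f` with `‖f‖ ≤ F` supported at sup-distance `≥ D_f` from both:
`(L^k/|x₀−x₁|_∞)^α·‖U(Γ_{x₀x₁})·(D_{u_k}G_k(□,u_k)f)(⟨x₁,μ⟩) − (D_{u_k}G_k(□,u_k)f)(⟨x₀,μ⟩)‖ ≤ c₀(L^kε)e^{−t₀D_f/L^k}F` — p27's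
`holder19_smallPlaquette_cube_uniform` at `θ = K·e𝓅(e)/(L^k)²` (file 1 §1–§2).
[cite: BalabanImbrieJaffe1985, (7.3.1) p.326 «also satisfy the regularity and decay estimates of [7]»]
[cite: Balaban1983RegularityDecay, Theorem p.573 (1.9)] [cite: BalabanImbrieJaffe1988, p.263 «Hölder derivatives of G_{k,loc}(u) of order less than two»] -/
theorem holder19_cube_actualBg (d L : ℕ) (hd1 : 1 ≤ d) (hd3 : d + 1 ≤ 3) (hL : Odd L ∧ 1 < L) {a : ℝ} (ha : 0 < a) (pexp : ℝ)
    {α : ℝ} (hα0 : 0 ≤ α) (hα1 : α < 1) :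
    ∃ c₁ t₀ c₀ : ℝ, 0 < c₁ ∧ 0 < t₀ ∧ 0 < c₀ ∧ ∀ (P : Params) (hPd : P.d = d + 1), P.L = L →
      ∀ (hd2 : 2 ≤ P.d) (k : ℕ), 1 ≤ k → k ≤ P.K → 2 * (P.L ^ k - 1) + 4 < P.sitesPerDir 0 →
      ∀ (e : ℝ), 0 < e → e ≤ 1 → e * (1 + Real.log e⁻¹) ^ pexp ≤ c₁ →
      ∀ (v : U1Field P k), (∀ q : TPlaq P k, ‖((plaq v q : Circle) : ℂ) - 1‖ ≤ e * (1 + Real.log e⁻¹) ^ pexp) →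
        ∀ (c M : Fin (d + 1) → ℕ), (∀ i, 1 ≤ M i) → (∀ i, c i * P.L ^ k + P.L ^ k * M i ≤ P.sitesPerDir 0) →
          (∀ i, P.L ^ k * M i < P.sitesPerDir 0) →
        ∀ (x₀ x₁ : TSite P 0) (μ : Fin P.d), x₀ ≠ x₁ →
          (∀ w, w ∉ cubeT hPd (P.L ^ k) c (fun i => P.L ^ k * M i) → 3 * P.L ^ k ≤ supDist x₀ w) →
          (∀ w, w ∉ cubeT hPd (P.L ^ k) c (fun i => P.L ^ k * M i) → 3 * P.L ^ k ≤ supDist x₁ w) →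
        ∀ (f : TSite P 0 → ℂ) (F D : ℝ),
          (∀ z, ‖f z‖ ≤ F) → (∀ z, f z ≠ 0 → D ≤ (supDist x₀ z : ℝ) ∧ D ≤ (supDist x₁ z : ℝ)) →
          (((P.L : ℝ) ^ k / (supDist x₀ x₁ : ℝ)) ^ α *
            ‖stairHol (actualBgU1 hd2 k e v) x₀ x₁ *
                covD P.eps⁻¹ (cfg (actualBgU1 hd2 k e v))
                  (gBox (B1RG242Torus.α P a k * (P.L : ℝ) ^ (k * P.d)) P.eps⁻¹ (actualBgU1 hd2 k e v) k
                    (cubeT hPd (P.L ^ k) c fun i => P.L ^ k * M i) *ᵥ f) ⟨x₁, μ⟩ -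
              covD P.eps⁻¹ (cfg (actualBgU1 hd2 k e v))
                  (gBox (B1RG242Torus.α P a k * (P.L : ℝ) ^ (k * P.d)) P.eps⁻¹ (actualBgU1 hd2 k e v) k
                    (cubeT hPd (P.L ^ k) c fun i => P.L ^ k * M i) *ᵥ f) ⟨x₀, μ⟩‖
            ≤ c₀ * P.spacing k * Real.exp (-(t₀ * D / (P.L : ℝ) ^ k)) * F) := by
  obtain ⟨K, hK1, HK⟩ := smallPlaquette_actualBg (d := d + 1) (L := L) (by omega) pexp
  obtain ⟨t₀, c₀, ht₀, hc₀, H⟩ := holder19_smallPlaquette_cube_uniform d L hd1 hd3 hL ha hα0 hα1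
  refine ⟨1 / (23 * ((d : ℝ) + 1) ^ 2 * K), t₀, c₀, by positivity, ht₀, hc₀, ?_⟩
  intro P hPd hPL hd2 k hk1 hkK hbig e he he1 hsm v hv c M hM hfit hN x₀ x₁ μ hne hdeep₀ hdeep₁ f F D hF hsupp
  have hk : k ≤ P.m + P.K := hkK.trans (Nat.le_add_left _ _)
  have hdr : (P.d : ℝ) = (d : ℝ) + 1 := by rw [hPd]; push_cast; ring
  rw [← hdr] at hsm
  obtain ⟨hθ0, -, hplaq, h1, hT, h2, -⟩ := HK P hPd hPL hd2 k hk1 hk e he he1 hsm v hv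
  exact H P hPd hPL k hk1 hkK hbig (actualBgU1 hd2 k e v) _ hθ0 hplaq h1 _ hT h2 c M hM hfit hN x₀ x₁ μ hne hdeep₀ hdeep₁ f F D
    hF hsupp

/-! ## §2 [7] (1.11)–(1.12): the closeness `δG_k(□, T_η, u_k)`, value and covariant-derivative members -/

/-- **[7] (1.11)–(1.12), VALUE MEMBER, FOR `δG_k(□, T_η, u_k) = G_k(□,u_k) − G_k(T_η,u_k)` AT THE ACTUAL BACKGROUND UNDER THE PRINTED (7.3.1).**
For `D = d + 1 ∈ {2, 3}`, `L = ℓ + 1` odd, `a > 0`, `𝓅`: there are `c₁ > 0` (`= 1/(23D²K)`) and `c₃, δ₃ > 0` (from `(d, ℓ, a)`) such that for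
EVERY torus, every `1 ≤ k ≤ K` with `2(L^k − 1) + 4 < |T|`, every `0 < e ≤ 1` with `e𝓅(e) ≤ c₁`, every `v` with (7.3.1), every fitting cube `□`
shorter than the torus, every row `x ∈ □` with `dist_∞(x, T∖□) ≥ 10L^k`, every `f` supported in `□` with `‖f‖ ≤ F`, `dist_∞(x, supp f) ≥ D_f`,
`dist_∞(x, T∖□) ≥ D_b`, `dist_∞(supp f, T∖□) ≥ D_{bf}` (all `≥ 0`):
`‖(G_k(□,u_k)f)(x) − (G_k(T_η,u_k)f)(x)‖ ≤ (L^kε)²·c₃e^{−δ₃D_f/L^k}e^{−δ₃(D_b+D_{bf})/L^k}F` — p30's `close112_smallPlaquette_cube_torus` at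
`θ = K·e𝓅(e)/(L^k)²` (file 1 §1 `plaqC` form, §2 `(L^{2k}θ)² ≤ 1/500`).
[cite: BalabanImbrieJaffe1985, (7.3.1) p.326 «also satisfy the regularity and decay estimates of [7]»]
[cite: Balaban1983RegularityDecay, Theorem p.573 (1.11)–(1.12)] [cite: BalabanImbrieJaffe1988, (2.31) p.263] -/
theorem close112_cube_actualBg (d ℓ : ℕ) (hd1 : 1 ≤ d) (hd3 : d + 1 ≤ 3) (hℓ : 1 ≤ ℓ) (hodd : Odd (ℓ + 1)) {a : ℝ} (ha : 0 < a)
    (pexp : ℝ) :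
    ∃ c₁ c₃ δ₃ : ℝ, 0 < c₁ ∧ 0 < c₃ ∧ 0 < δ₃ ∧ ∀ (P : Params) (hPd : P.d = d + 1), P.L = ℓ + 1 →
      ∀ (hd2 : 2 ≤ P.d) (k : ℕ), 1 ≤ k → k ≤ P.K → 2 * (P.L ^ k - 1) + 4 < P.sitesPerDir 0 →
      ∀ (e : ℝ), 0 < e → e ≤ 1 → e * (1 + Real.log e⁻¹) ^ pexp ≤ c₁ →
      ∀ (v : U1Field P k), (∀ q : TPlaq P k, ‖((plaq v q : Circle) : ℂ) - 1‖ ≤ e * (1 + Real.log e⁻¹) ^ pexp) →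
      ∀ (c M : Fin (d + 1) → ℕ), (∀ i, 1 ≤ M i) → (∀ i, c i * P.L ^ k + P.L ^ k * M i ≤ P.sitesPerDir 0) →
        (∀ i, P.L ^ k * M i < P.sitesPerDir 0) →
      ∀ x ∈ cubeT hPd (P.L ^ k) c (fun i => P.L ^ k * M i),
        (∀ w, w ∉ cubeT hPd (P.L ^ k) c (fun i => P.L ^ k * M i) → 10 * (P.L : ℝ) ^ k ≤ B5Ineq137Torus.T P 0 x w) →
      ∀ (f : TSite P 0 → ℂ) (F D Db Df : ℝ), (∀ y, ‖f y‖ ≤ F) →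
        (∀ y, y ∉ cubeT hPd (P.L ^ k) c (fun i => P.L ^ k * M i) → f y = 0) →
        0 ≤ D → (∀ y, f y ≠ 0 → D ≤ B5Ineq137Torus.T P 0 x y) → 0 ≤ Db →
        (∀ w, w ∉ cubeT hPd (P.L ^ k) c (fun i => P.L ^ k * M i) → Db ≤ B5Ineq137Torus.T P 0 x w) →
        0 ≤ Df → (∀ y, f y ≠ 0 → ∀ w, w ∉ cubeT hPd (P.L ^ k) c (fun i => P.L ^ k * M i) → Df ≤ B5Ineq137Torus.T P 0 y w) →
        ‖(gBox (B1RG242Torus.α P a k * (P.L : ℝ) ^ (k * P.d)) P.eps⁻¹ (actualBgU1 hd2 k e v) k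
              (cubeT hPd (P.L ^ k) c fun i => P.L ^ k * M i) *ᵥ f) x -
            (gBox (B1RG242Torus.α P a k * (P.L : ℝ) ^ (k * P.d)) P.eps⁻¹ (actualBgU1 hd2 k e v) k univ *ᵥ f) x‖ ≤
          P.spacing k ^ 2 * (c₃ * Real.exp (-(δ₃ * (((P.L : ℝ) ^ k)⁻¹ * D))) *
            Real.exp (-(δ₃ * (((P.L : ℝ) ^ k)⁻¹ * (Db + Df)))) * F) := by
  obtain ⟨K, hK1, HK⟩ := smallPlaquette_actualBg (d := d + 1) (L := ℓ + 1) (by omega) pexp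
  obtain ⟨c₃, δ₃, hc₃, hδ₃, H⟩ := close112_smallPlaquette_cube_torus d ℓ hd1 hd3 hℓ hodd ha
  refine ⟨1 / (23 * ((d : ℝ) + 1) ^ 2 * K), c₃, δ₃, by positivity, hc₃, hδ₃, ?_⟩
  intro P hPd hPL hd2 k hk1 hkK hbig e he he1 hsm v hv c M hM hfit hN x hx hdeep f F D Db Df hF hfB hD hsD hDb hsDb hDf hsDf
  have hk : k ≤ P.m + P.K := hkK.trans (Nat.le_add_left _ _)
  have hdr : (P.d : ℝ) = (d : ℝ) + 1 := by rw [hPd]; push_cast; ring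
  rw [← hdr] at hsm
  obtain ⟨hθ0, hplaqC, -, -, -, -, h3⟩ := HK P hPd hPL hd2 k hk1 hk e he he1 hsm v hv
  exact H P hPd hPL k hk1 hkK hbig (actualBgU1 hd2 k e v) _ hθ0 hplaqC h3 c M hM hfit hN x hx hdeep f F D Db Df hF hfB hD hsD hDb
    hsDb hDf hsDf

/-- **[7] (1.11)–(1.12), COVARIANT-DERIVATIVE MEMBER, FOR `δG_k(□, T_η, u_k)` AT THE ACTUAL BACKGROUND UNDER THE PRINTED (7.3.1)**, same data
with rows of depth `≥ 14L^k` and every direction `μ`: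
`‖(D_{u_k}G_k(□,u_k)f)(⟨x,μ⟩) − (D_{u_k}G_k(T_η,u_k)f)(⟨x,μ⟩)‖ ≤ (L^kε)·c₃e^{−δ₃D_f/L^k}e^{−δ₃(D_b+D_{bf})/L^k}F` — p30's
`close112_smallPlaquette_cube_torus_deriv` at `θ = K·e𝓅(e)/(L^k)²`.
[cite: BalabanImbrieJaffe1985, (7.3.1) p.326 «also satisfy the regularity and decay estimates of [7]»]
[cite: Balaban1983RegularityDecay, Theorem p.573 (1.10)–(1.12)] [cite: BalabanImbrieJaffe1988, p.263 «Bounds analogous to (2.30), (2.31) hold for covariant derivatives»] -/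
theorem close112_cube_deriv_actualBg (d ℓ : ℕ) (hd1 : 1 ≤ d) (hd3 : d + 1 ≤ 3) (hℓ : 1 ≤ ℓ) (hodd : Odd (ℓ + 1)) {a : ℝ} (ha : 0 < a)
    (pexp : ℝ) :
    ∃ c₁ c₃ δ₃ : ℝ, 0 < c₁ ∧ 0 < c₃ ∧ 0 < δ₃ ∧ ∀ (P : Params) (hPd : P.d = d + 1), P.L = ℓ + 1 →
      ∀ (hd2 : 2 ≤ P.d) (k : ℕ), 1 ≤ k → k ≤ P.K → 2 * (P.L ^ k - 1) + 4 < P.sitesPerDir 0 →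
      ∀ (e : ℝ), 0 < e → e ≤ 1 → e * (1 + Real.log e⁻¹) ^ pexp ≤ c₁ →
      ∀ (v : U1Field P k), (∀ q : TPlaq P k, ‖((plaq v q : Circle) : ℂ) - 1‖ ≤ e * (1 + Real.log e⁻¹) ^ pexp) →
      ∀ (c M : Fin (d + 1) → ℕ), (∀ i, 1 ≤ M i) → (∀ i, c i * P.L ^ k + P.L ^ k * M i ≤ P.sitesPerDir 0) →
        (∀ i, P.L ^ k * M i < P.sitesPerDir 0) →
      ∀ x ∈ cubeT hPd (P.L ^ k) c (fun i => P.L ^ k * M i),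
        (∀ w, w ∉ cubeT hPd (P.L ^ k) c (fun i => P.L ^ k * M i) → 14 * (P.L : ℝ) ^ k ≤ B5Ineq137Torus.T P 0 x w) →
      ∀ (f : TSite P 0 → ℂ) (F D Db Df : ℝ), (∀ y, ‖f y‖ ≤ F) →
        (∀ y, y ∉ cubeT hPd (P.L ^ k) c (fun i => P.L ^ k * M i) → f y = 0) →
        0 ≤ D → (∀ y, f y ≠ 0 → D ≤ B5Ineq137Torus.T P 0 x y) → 0 ≤ Db →
        (∀ w, w ∉ cubeT hPd (P.L ^ k) c (fun i => P.L ^ k * M i) → Db ≤ B5Ineq137Torus.T P 0 x w) →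
        0 ≤ Df → (∀ y, f y ≠ 0 → ∀ w, w ∉ cubeT hPd (P.L ^ k) c (fun i => P.L ^ k * M i) → Df ≤ B5Ineq137Torus.T P 0 y w) →
        ∀ (μ : Fin P.d),
        ‖covD P.eps⁻¹ (cfg (actualBgU1 hd2 k e v)) (gBox (B1RG242Torus.α P a k * (P.L : ℝ) ^ (k * P.d)) P.eps⁻¹
              (actualBgU1 hd2 k e v) k (cubeT hPd (P.L ^ k) c fun i => P.L ^ k * M i) *ᵥ f) ⟨x, μ⟩ -
            covD P.eps⁻¹ (cfg (actualBgU1 hd2 k e v)) (gBox (B1RG242Torus.α P a k * (P.L : ℝ) ^ (k * P.d)) P.eps⁻¹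
              (actualBgU1 hd2 k e v) k univ *ᵥ f) ⟨x, μ⟩‖ ≤
          P.spacing k * (c₃ * Real.exp (-(δ₃ * (((P.L : ℝ) ^ k)⁻¹ * D))) *
            Real.exp (-(δ₃ * (((P.L : ℝ) ^ k)⁻¹ * (Db + Df)))) * F) := by
  obtain ⟨K, hK1, HK⟩ := smallPlaquette_actualBg (d := d + 1) (L := ℓ + 1) (by omega) pexp
  obtain ⟨c₃, δ₃, hc₃, hδ₃, H⟩ := close112_smallPlaquette_cube_torus_deriv d ℓ hd1 hd3 hℓ hodd ha
  refine ⟨1 / (23 * ((d : ℝ) + 1) ^ 2 * K), c₃, δ₃, by positivity, hc₃, hδ₃, ?_⟩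
  intro P hPd hPL hd2 k hk1 hkK hbig e he he1 hsm v hv c M hM hfit hN x hx hdeep f F D Db Df hF hfB hD hsD hDb hsDb hDf hsDf μ
  have hk : k ≤ P.m + P.K := hkK.trans (Nat.le_add_left _ _)
  have hdr : (P.d : ℝ) = (d : ℝ) + 1 := by rw [hPd]; push_cast; ring
  rw [← hdr] at hsm
  obtain ⟨hθ0, hplaqC, -, -, -, -, h3⟩ := HK P hPd hPL hd2 k hk1 hk e he he1 hsm v hv
  exact H P hPd hPL k hk1 hkK hbig (actualBgU1 hd2 k e v) _ hθ0 hplaqC h3 c M hM hfit hN x hx hdeep f F D Db Df hF hfB hD hsD hDb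
    hsDb hDf hsDf μ

/-! ## §3 [7] (1.11)–(1.12): the Hölder member of top order for `δG_k(□, T_η, u_k)` -/

/-- **[7] (1.11)–(1.12), HÖLDER MEMBER OF TOP ORDER (`0 ≤ α < 1`), FOR `δG_k(□, T_η, u_k)` AT THE ACTUAL BACKGROUND UNDER THE PRINTED
(7.3.1)**: same data with a pair `x₀ ≠ x₁` in `□`, both of depth `≥ 17L^k`, `f` supported in `□` at sup-distance `≥ D_f` from both:
`(L^k/|x₀−x₁|_∞)^α·‖U(Γ_{x₀x₁})(D_{u_k}δG f)(⟨x₁,μ⟩) − (D_{u_k}δG f)(⟨x₀,μ⟩)‖ ≤ (L^kε)·c₃e^{−δ₃D_f/L^k}e^{−δ₃(D_b+D_{bf})/L^k}F`,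
`δG = G_k(□,u_k) − G_k(T_η,u_k)` — p27's `closeHolder112_smallPlaquette_cube_torus` at `θ = K·e𝓅(e)/(L^k)²`.
[cite: BalabanImbrieJaffe1985, (7.3.1) p.326 «also satisfy the regularity and decay estimates of [7]»]
[cite: Balaban1983RegularityDecay, Theorem p.573 (1.9), (1.11)–(1.12)] [cite: BalabanImbrieJaffe1988, p.263 «Hölder derivatives of G_{k,loc}(u) of order less than two»] -/
theorem closeHolder112_cube_actualBg (d ℓ : ℕ) (hd1 : 1 ≤ d) (hd3 : d + 1 ≤ 3) (hℓ : 1 ≤ ℓ) (hodd : Odd (ℓ + 1)) {a : ℝ} (ha : 0 < a)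
    (pexp : ℝ) {α : ℝ} (hα0 : 0 ≤ α) (hα1 : α < 1) :
    ∃ c₁ c₃ δ₃ : ℝ, 0 < c₁ ∧ 0 < c₃ ∧ 0 < δ₃ ∧ ∀ (P : Params) (hPd : P.d = d + 1), P.L = ℓ + 1 →
      ∀ (hd2 : 2 ≤ P.d) (k : ℕ), 1 ≤ k → k ≤ P.K → 2 * (P.L ^ k - 1) + 4 < P.sitesPerDir 0 →
      ∀ (e : ℝ), 0 < e → e ≤ 1 → e * (1 + Real.log e⁻¹) ^ pexp ≤ c₁ →
      ∀ (v : U1Field P k), (∀ q : TPlaq P k, ‖((plaq v q : Circle) : ℂ) - 1‖ ≤ e * (1 + Real.log e⁻¹) ^ pexp) →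
      ∀ (c M : Fin (d + 1) → ℕ), (∀ i, 1 ≤ M i) → (∀ i, c i * P.L ^ k + P.L ^ k * M i ≤ P.sitesPerDir 0) →
        (∀ i, P.L ^ k * M i < P.sitesPerDir 0) →
      ∀ (x₀ x₁ : TSite P 0) (μ : Fin P.d), x₀ ≠ x₁ →
        x₀ ∈ cubeT hPd (P.L ^ k) c (fun i => P.L ^ k * M i) → x₁ ∈ cubeT hPd (P.L ^ k) c (fun i => P.L ^ k * M i) →
        (∀ w, w ∉ cubeT hPd (P.L ^ k) c (fun i => P.L ^ k * M i) → 17 * (P.L : ℝ) ^ k ≤ B5Ineq137Torus.T P 0 x₀ w) →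
        (∀ w, w ∉ cubeT hPd (P.L ^ k) c (fun i => P.L ^ k * M i) → 17 * (P.L : ℝ) ^ k ≤ B5Ineq137Torus.T P 0 x₁ w) →
      ∀ (f : TSite P 0 → ℂ) (F D Db Df : ℝ), (∀ y, ‖f y‖ ≤ F) →
        (∀ y, y ∉ cubeT hPd (P.L ^ k) c (fun i => P.L ^ k * M i) → f y = 0) →
        0 ≤ D → (∀ y, f y ≠ 0 → D ≤ B5Ineq137Torus.T P 0 x₀ y) → (∀ y, f y ≠ 0 → D ≤ B5Ineq137Torus.T P 0 x₁ y) →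
        0 ≤ Db → (∀ w, w ∉ cubeT hPd (P.L ^ k) c (fun i => P.L ^ k * M i) → Db ≤ B5Ineq137Torus.T P 0 x₀ w) →
        (∀ w, w ∉ cubeT hPd (P.L ^ k) c (fun i => P.L ^ k * M i) → Db ≤ B5Ineq137Torus.T P 0 x₁ w) →
        0 ≤ Df → (∀ y, f y ≠ 0 → ∀ w, w ∉ cubeT hPd (P.L ^ k) c (fun i => P.L ^ k * M i) → Df ≤ B5Ineq137Torus.T P 0 y w) →
        ((P.L : ℝ) ^ k / B5Ineq137Torus.T P 0 x₀ x₁) ^ α *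
            ‖stairHol (actualBgU1 hd2 k e v) x₀ x₁ *
                covD P.eps⁻¹ (cfg (actualBgU1 hd2 k e v))
                  (gBox (B1RG242Torus.α P a k * (P.L : ℝ) ^ (k * P.d)) P.eps⁻¹ (actualBgU1 hd2 k e v) k
                      (cubeT hPd (P.L ^ k) c fun i => P.L ^ k * M i) *ᵥ f -
                    gBox (B1RG242Torus.α P a k * (P.L : ℝ) ^ (k * P.d)) P.eps⁻¹ (actualBgU1 hd2 k e v) k univ *ᵥ f) ⟨x₁, μ⟩ -
              covD P.eps⁻¹ (cfg (actualBgU1 hd2 k e v))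
                  (gBox (B1RG242Torus.α P a k * (P.L : ℝ) ^ (k * P.d)) P.eps⁻¹ (actualBgU1 hd2 k e v) k
                      (cubeT hPd (P.L ^ k) c fun i => P.L ^ k * M i) *ᵥ f -
                    gBox (B1RG242Torus.α P a k * (P.L : ℝ) ^ (k * P.d)) P.eps⁻¹ (actualBgU1 hd2 k e v) k univ *ᵥ f) ⟨x₀, μ⟩‖
          ≤ P.spacing k * (c₃ * Real.exp (-(δ₃ * (((P.L : ℝ) ^ k)⁻¹ * D))) *
              Real.exp (-(δ₃ * (((P.L : ℝ) ^ k)⁻¹ * (Db + Df)))) * F) := by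
  obtain ⟨K, hK1, HK⟩ := smallPlaquette_actualBg (d := d + 1) (L := ℓ + 1) (by omega) pexp
  obtain ⟨c₃, δ₃, hc₃, hδ₃, H⟩ := closeHolder112_smallPlaquette_cube_torus d ℓ hd1 hd3 hℓ hodd ha hα0 hα1
  refine ⟨1 / (23 * ((d : ℝ) + 1) ^ 2 * K), c₃, δ₃, by positivity, hc₃, hδ₃, ?_⟩
  intro P hPd hPL hd2 k hk1 hkK hbig e he he1 hsm v hv c M hM hfit hN x₀ x₁ μ hne hx₀ hx₁ hdeep₀ hdeep₁ f F D Db Df hF hfB hD hsD₀ hsD₁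
    hDb hsDb₀ hsDb₁ hDf hsDf
  have hk : k ≤ P.m + P.K := hkK.trans (Nat.le_add_left _ _)
  have hdr : (P.d : ℝ) = (d : ℝ) + 1 := by rw [hPd]; push_cast; ring
  rw [← hdr] at hsm
  obtain ⟨hθ0, hplaqC, -, -, -, -, h3⟩ := HK P hPd hPL hd2 k hk1 hk e he he1 hsm v hv
  exact H P hPd hPL k hk1 hkK hbig (actualBgU1 hd2 k e v) _ hθ0 hplaqC h3 c M hM hfit hN x₀ x₁ μ hne hx₀ hx₁ hdeep₀ hdeep₁ f F D Db Df
    hF hfB hD hsD₀ hsD₁ hDb hsDb₀ hsDb₁ hDf hsDf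

end

end Literature.MathematicalPhysics.QuantumFieldTheory.BalabanImbrieJaffe1984to88.BIJ88NeumannPropagatorActualBackgroundCube
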